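import Mathlib
import HarnessLib
import Literature.Analysis.FluidPDE.SelfSimilar
import Literature.Analysis.FluidPDE.LocalTypeI
import Literature.Analysis.FluidPDE.VectorCalculus
import Literature.Analysis.FluidPDE.VorticityCalculus
import Literature.Analysis.FluidPDE.TaoEnstrophyLocalisation
import Literature.Analysis.FluidPDE.CurlFreeLiouville
import Literature.Analysis.FluidPDE.HarmonicLiouvilleLp
import Literature.Analysis.FluidPDE.BoundedAnnihilator
import Literature.Analysis.FluidPDE.KNSSThm52Integrand
import Literature.Analysis.FluidPDE.TypeIAncientMild
import Literature.Analysis.FluidPDE.GigaMiura2011ScaledAlignmentBlowupLimitHolds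
import Literature.Analysis.UnboundedOperators.HeatKernel
import Summits.NavierStokesRegularity.NavierStokesRegularity.Theorems.LocalSineTubeDoorProfileAlignedWindowRigidityAncient
import Summits.NavierStokesRegularity.NavierStokesRegularity.Theorems.PoloidalWindowDoorPoloidalWindowRigidityWindow
import Summits.NavierStokesRegularity.NavierStokesRegularity.Theorems.PoloidalWindowDoorPoloidalWindowRigidityFlat
import Summits.NavierStokesRegularity.NavierStokesRegularity.Theorems.PoloidalWindowDoorPoloidalWindowRigidityOneSlice

/-!
# Route `PoloidalWindowDoor`, crux `PoloidalWindowRigidity` (K2, stmt-NavierStokesRegularity-19708) — two further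
# SETTLED STRATA of the open residue: vorticity translation-invariant along a line, and harmonic vorticity

Cell ns-regularity-ideate, seat ns-poloidal-K2-p3 (stub-worker on K2; support theorems `--supports` the crux item,
no claim on the crux).  The open stub `stub_nonflatLiouville` / `stub_sliceSharpNonflatLiouville` of the crux is the
Type-I Liouville problem on the poloidal stratum; the settled strata so far (seat p6: vorticity aligned, poloidal in
two directions, vertically rigid, flat, axisymmetric about any axis, VELOCITY translation-invariant along a line,
scale-invariant, steady / time-periodic, irrotational) are hypotheses the residue prover may negate on every slice.
This file adds two strata, both on ONE slice and both WITHOUT the poloidal hypothesis: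

* `periodic_of_curl_periodic` — the vector-calculus core: a bounded, `C²`, divergence-free field on `ℝ³` whose CURL
  is invariant under the translation by `p` is itself invariant under that translation (the difference field
  `V(· + p) − V` is bounded, curl-free and divergence-free, hence constant by the tree's div–curl Liouville theorem
  `eq_of_curl_eq_zero_of_isDivFree_of_bounded`; a bounded function with a constant increment has increment `0`);
* `eq_zero_of_curl_translate_eq_slice` / `nonflatLiouville_of_curl_translate_eq_slice` — **stratum (A)**: a profile
  of the route's Type-I class whose VORTICITY is, on ONE slice `s < 0`, invariant under the translations along some
  `e ≠ 0` vanishes identically (its velocity slice is then translation-invariant, and p6's one-slice (N₁) theorem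
  `…OneSlice.eq_zero_of_translate_eq_slice` applies) — strictly weaker hypothesis than velocity invariance;
* `exists_norm_iteratedFDeriv_slice_le` — every slice of a profile of the class has bounded derivatives of every
  order (KNSS 2009 (4.10), tree `exists_norm_iteratedFDeriv_le_of_bounded_oseenMild`, after the time shift
  `t ↦ t − δ` that makes the Type-I profile a bounded Oseen-mild field);
* `curl_slice_const_of_harmonic` / `eq_zero_of_curl_harmonic_slice` / `nonflatLiouville_of_curl_harmonic_slice` —
  **stratum (B)**: if ONE vorticity slice is (vector-)harmonic, `Δ curl v(s) ≡ 0`, the profile vanishes identically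
  (the slice vorticity is bounded, so each coordinate is a bounded harmonic function, constant by Liouville; a
  constant vorticity is translation-invariant, and (A) applies).  This is the inviscid-degenerate stratum
  `{Δω ≡ 0}` on which the INFINITESIMAL rigidity conjecture of the cell FAILS (nsreg-p1 R9-PREP §7.2/§7.5: the
  linear-vorticity stagnation family `U♭`, kernel datum `…LinearNonrigidity`); inside the Type-I class it is empty.

WHAT THIS IS NOT: not a claim about Navier–Stokes regularity and not the open stub — two more settled strata of the
residue of K2, for the OPEN door route PoloidalWindowDoor (bears_on LADDER-NS N0, rung N0-LocalTubeDoorPoloidal).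
-/

noncomputable section

-- the summit and its single sub-problem share the name (CONVENTIONS §1), as in every Theorems file
set_option linter.dupNamespace false

namespace Summit.NavierStokesRegularity.NavierStokesRegularity.Theorems.PoloidalWindowDoorPoloidalWindowRigidityVorticityTranslate

open MeasureTheory Set Function Filter Topology TopologicalSpace Metric InnerProductSpace
open scoped RealInnerProductSpace InnerProductSpace Laplacian ContDiff
open Literature.Analysis Literature.Analysis.FluidPDE
open Summit.NavierStokesRegularity.NavierStokesRegularity.Theorems.LocalSineTubeDoorProfileAlignedWindowRigidityAncient
open Summit.NavierStokesRegularity.NavierStokesRegularity.Theorems.PoloidalWindowDoorPoloidalWindowRigidityWindow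
open Summit.NavierStokesRegularity.NavierStokesRegularity.Theorems.PoloidalWindowDoorPoloidalWindowRigidityFlat
open Summit.NavierStokesRegularity.NavierStokesRegularity.Theorems.PoloidalWindowDoorPoloidalWindowRigidityOneSlice

/-! ### The vector-calculus core: a bounded incompressible field with translation-invariant curl is translation-invariant -/

/-- **A bounded function with a constant increment has increment zero**: if `V (x + p) = V x + c` for all `x` and
`‖V‖ ≤ M`, then `c = 0` (iterate: `V (x + n • p) = V x + n • c`, so `n ‖c‖ ≤ 2M` for every `n`). -/
theorem increment_eq_zero_of_bounded {F : Type*} [NormedAddCommGroup F] [NormedSpace ℝ F]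
    {V : EuclideanSpace ℝ (Fin 3) → F} {M : ℝ} (hM : ∀ x, ‖V x‖ ≤ M) {p : EuclideanSpace ℝ (Fin 3)} {c : F}
    (hc : ∀ x, V (x + p) = V x + c) : c = 0 := by
  have hiter : ∀ n : ℕ, V ((n : ℝ) • p) = V 0 + (n : ℝ) • c := by
    intro n
    induction n with
    | zero => simp
    | succ n ih =>
      have e : ((n + 1 : ℕ) : ℝ) • p = (n : ℝ) • p + p := by push_cast; rw [add_smul, one_smul]
      rw [e, hc, ih]
      push_cast
      rw [add_smul, one_smul, add_assoc]
  have hbound : ∀ n : ℕ, (n : ℝ) * ‖c‖ ≤ 2 * M := fun n => by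
    have h1 : ‖(n : ℝ) • c‖ = ‖V ((n : ℝ) • p) - V 0‖ := by rw [hiter n, add_sub_cancel_left]
    rw [norm_smul, Real.norm_natCast] at h1
    rw [h1]
    exact (norm_sub_le _ _).trans (by linarith [hM ((n : ℝ) • p), hM 0])
  by_contra hne
  have hcpos : 0 < ‖c‖ := norm_pos_iff.2 hne
  obtain ⟨n, hn⟩ := exists_nat_gt (2 * M / ‖c‖)
  have := hbound n
  rw [div_lt_iff₀ hcpos] at hn
  linarith

/-- **curl translation-invariant ⇒ field translation-invariant, for bounded incompressible `C²` fields on `ℝ³`.**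
If `V ∈ C²(ℝ³, ℝ³)` is bounded and divergence-free and `curl V (x + p) = curl V x` for all `x`, then
`V (x + p) = V x` for all `x`: the difference field `W = V(· + p) − V` is `C²`, bounded, curl-free and divergence-free,
hence constant (tree `eq_of_curl_eq_zero_of_isDivFree_of_bounded`, KNSS 2009 Lemma 3.1's Liouville step), and a
bounded field with constant increment has increment `0` (`increment_eq_zero_of_bounded`). -/
theorem periodic_of_curl_periodic {V : EuclideanSpace ℝ (Fin 3) → EuclideanSpace ℝ (Fin 3)} (hV : ContDiff ℝ 2 V)
    (hdiv : VectorCalculus.IsDivFree V) {M : ℝ} (hM : ∀ x, ‖V x‖ ≤ M) {p : EuclideanSpace ℝ (Fin 3)}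
    (hp : ∀ x, curl V (x + p) = curl V x) : ∀ x, V (x + p) = V x := by
  -- the difference field
  set W : EuclideanSpace ℝ (Fin 3) → EuclideanSpace ℝ (Fin 3) := fun y => V (y + p) - V y with hW
  have hVp : ContDiff ℝ 2 (fun y => V (y + p)) := hV.comp (contDiff_id.add contDiff_const)
  have hW2 : ContDiff ℝ 2 W := hVp.sub hV
  have hdW : ∀ x, fderiv ℝ W x = fderiv ℝ V (x + p) - fderiv ℝ V x := fun x => by
    have hf : DifferentiableAt ℝ (fun y => V (y + p)) x := (hVp.differentiable (by norm_num)) x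
    have hg : DifferentiableAt ℝ V x := (hV.differentiable (by norm_num)) x
    rw [hW, fderiv_fun_sub hf hg, fderiv_comp_add_right]
  have hcurlW : ∀ x, curl W x = 0 := fun x => by
    rw [curl_eq_curlCLM, hdW x, map_sub, ← curl_eq_curlCLM, ← curl_eq_curlCLM, hp x, sub_self]
  have hdivW : VectorCalculus.IsDivFree W := fun x => by
    have h1 := hdiv (x + p)
    have h2 := hdiv x
    unfold VectorCalculus.divergence at h1 h2 ⊢
    rw [hdW x, ContinuousLinearMap.toLinearMap_sub, map_sub, h1, h2, sub_self]
  have hWbd : ∀ x, ‖W x‖ ≤ 2 * M := fun x =>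
    (norm_sub_le _ _).trans (by linarith [hM (x + p), hM x])
  -- `W` is constant …
  have hconst := eq_of_curl_eq_zero_of_isDivFree_of_bounded hW2 hcurlW hdivW hWbd
  -- … and the constant is `0`
  have hc : ∀ x, V (x + p) = V x + W 0 := fun x => by
    rw [← hconst x 0]
    simp [hW]
  have h0 : W 0 = 0 := increment_eq_zero_of_bounded hM hc
  intro x
  rw [hc x, h0, add_zero]

/-- **curl invariant under the translations along `e` ⇒ field invariant under them** (bounded incompressible `C²`
fields on `ℝ³`; `periodic_of_curl_periodic` for every `p = l • e`). -/
theorem translate_eq_of_curl_translate_eq {V : EuclideanSpace ℝ (Fin 3) → EuclideanSpace ℝ (Fin 3)} (hV : ContDiff ℝ 2 V)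
    (hdiv : VectorCalculus.IsDivFree V) {M : ℝ} (hM : ∀ x, ‖V x‖ ≤ M) {e : EuclideanSpace ℝ (Fin 3)}
    (h : ∀ (x : EuclideanSpace ℝ (Fin 3)) (l : ℝ), curl V (x + l • e) = curl V x) :
    ∀ (x : EuclideanSpace ℝ (Fin 3)) (l : ℝ), V (x + l • e) = V x := fun x l =>
  periodic_of_curl_periodic hV hdiv hM (fun y => h y l) x

/-! ### Stratum (A): vorticity translation-invariant along a line on ONE slice -/

variable {C : ℝ} {v : ℝ → EuclideanSpace ℝ (Fin 3) → EuclideanSpace ℝ (Fin 3)}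

/-- **Stratum (A).** A profile of the route's Type-I class (rate `‖v(t,y)‖ ≤ C/√(−t)`, continuity on the open slab,
unit-viscosity Oseen-mild identity, divergence-free slices) whose VORTICITY is, on ONE slice `s < 0`, invariant under
the translations along some `e ≠ 0` (`curl v(s) (y + l e) = curl v(s) y` for all `y`, `l`) vanishes identically:
the slice `v(s)` is `C²` (real-analytic), bounded and divergence-free, so it is itself invariant under these
translations (`translate_eq_of_curl_translate_eq`), and p6's one-slice (N₁) theorem `eq_zero_of_translate_eq_slice`
concludes.  No poloidality is needed. -/
theorem eq_zero_of_curl_translate_eq_slice (hrate : HasTypeITimeDecay C v)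
    (hcont : ContinuousOn (uncurry v) (Iio (0 : ℝ) ×ˢ univ))
    (hmild : ∀ s t : ℝ, s < t → t < 0 → ∀ x,
      v t x = UnboundedOperators.heatExtension (v s) (t - s) x - oseenDuhamel 1 s v v t x)
    (hdiv : ∀ t < 0, VectorCalculus.IsDivFree (v t)) {s : ℝ} (hs : s < 0)
    {e : EuclideanSpace ℝ (Fin 3)} (he : e ≠ 0)
    (h : ∀ (y : EuclideanSpace ℝ (Fin 3)) (l : ℝ), curl (v s) (y + l • e) = curl (v s) y) :
    ∀ t < 0, ∀ x, v t x = 0 := by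
  have hbdd := bdd_of_hasTypeITimeDecay hrate
  have hC2 : ContDiff ℝ 2 (v s) := (analyticOnNhd_slice hcont hbdd hmild hs).contDiff
  have hinv : ∀ (y : EuclideanSpace ℝ (Fin 3)) (l : ℝ), v s (y + l • e) = v s y :=
    translate_eq_of_curl_translate_eq hC2 (hdiv s hs) (fun y => hrate s hs y) h
  exact eq_zero_of_translate_eq_slice hrate hcont hmild hdiv hs he hinv

/-- **Stratum (A), not backward-singular**: vorticity translation-invariant along a line on one slice ⇒ the apex
`(0,0)` is not a backward singular point. -/
theorem nonflatLiouville_of_curl_translate_eq_slice (hrate : HasTypeITimeDecay C v)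
    (hcont : ContinuousOn (uncurry v) (Iio (0 : ℝ) ×ˢ univ))
    (hmild : ∀ s t : ℝ, s < t → t < 0 → ∀ x,
      v t x = UnboundedOperators.heatExtension (v s) (t - s) x - oseenDuhamel 1 s v v t x)
    (hdiv : ∀ t < 0, VectorCalculus.IsDivFree (v t)) {s : ℝ} (hs : s < 0)
    {e : EuclideanSpace ℝ (Fin 3)} (he : e ≠ 0)
    (h : ∀ (y : EuclideanSpace ℝ (Fin 3)) (l : ℝ), curl (v s) (y + l • e) = curl (v s) y) :
    ¬ IsBackwardSingularPoint v 0 :=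
  not_backwardSingular_of_zero (eq_zero_of_curl_translate_eq_slice hrate hcont hmild hdiv hs he h)

/-! ### Bounded derivatives of every order on every slice (KNSS 2009 (4.10) after a time shift) -/

/-- **Every slice of a profile of the class has bounded derivatives of every order**: for `k : ℕ` and `s < 0` there
is `K` with `‖Dᵏ v(s)(x)‖ ≤ K` for all `x`.  Proof: the time-shifted field `t ↦ v(t − δ)`, `δ = −s/2`, is in the
class (`IsTypeIAncientMild.comp_sub_right`) and BOUNDED on the whole past by `|C|/√δ`, so KNSS 2009 (4.10) in the
tree's window form `exists_norm_iteratedFDeriv_le_of_bounded_oseenMild` bounds all its `x`-derivatives on the window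
`[s/2, s/4)`, whose left endpoint is the slice `v(s)`. -/
theorem exists_norm_iteratedFDeriv_slice_le (hrate : HasTypeITimeDecay C v)
    (hcont : ContinuousOn (uncurry v) (Iio (0 : ℝ) ×ˢ univ))
    (hmild : ∀ s t : ℝ, s < t → t < 0 → ∀ x,
      v t x = UnboundedOperators.heatExtension (v s) (t - s) x - oseenDuhamel 1 s v v t x)
    (hdiv : ∀ t < 0, VectorCalculus.IsDivFree (v t)) (k : ℕ) {s : ℝ} (hs : s < 0) :
    ∃ K : ℝ, ∀ x, ‖iteratedFDeriv ℝ k (v s) x‖ ≤ K := by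
  have hA : IsTypeIAncientMild C v := isTypeIAncientMild_of_class hrate hcont hmild hdiv
  set δ : ℝ := -s / 2 with hδ
  have hδ0 : 0 < δ := by rw [hδ]; linarith
  have hA' : IsTypeIAncientMild C (fun t => v (t - δ)) := hA.comp_sub_right hδ0.le
  obtain ⟨B, hB⟩ := bdd_of_hasTypeITimeDecay hrate δ hδ0
  obtain ⟨K, hK⟩ := exists_norm_iteratedFDeriv_le_of_bounded_oseenMild B k hδ0 (half_pos hδ0)
  refine ⟨K, fun x => ?_⟩
  have key := hK (A := 2 * s) (a := 3 * s / 4) (u := fun t => v (t - δ)) (by linarith) (by rw [hδ]; linarith)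
    (hA'.continuousOn_uncurry.mono (prod_mono Ioo_subset_Iio_self Subset.rfl))
    (fun t ht => hA'.isWeaklyDivFree ht.2)
    (fun s' t' _ hst' ht' y => hA'.mild_eq_heatExtension hst' ht' y)
    (fun t ht y => hB (t - δ) (by linarith [ht.2]) y)
    (s / 2) ⟨by rw [hδ]; linarith, by rw [hδ]; linarith⟩ x
  have e1 : s / 2 - δ = s := by rw [hδ]; ring
  simpa only [e1] using key

/-- **Bounded vorticity on every slice** (order `1` of `exists_norm_iteratedFDeriv_slice_le` and
`‖curl w‖ ≤ ‖curlCLM‖ ‖Dw‖`). -/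
theorem exists_norm_curl_slice_le (hrate : HasTypeITimeDecay C v)
    (hcont : ContinuousOn (uncurry v) (Iio (0 : ℝ) ×ˢ univ))
    (hmild : ∀ s t : ℝ, s < t → t < 0 → ∀ x,
      v t x = UnboundedOperators.heatExtension (v s) (t - s) x - oseenDuhamel 1 s v v t x)
    (hdiv : ∀ t < 0, VectorCalculus.IsDivFree (v t)) {s : ℝ} (hs : s < 0) :
    ∃ K : ℝ, ∀ x, ‖curl (v s) x‖ ≤ K := by
  have hbdd := bdd_of_hasTypeITimeDecay hrate
  have hC1 : ContDiff ℝ (0 + 1) (v s) := (analyticOnNhd_slice hcont hbdd hmild hs).contDiff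
  obtain ⟨K, hK⟩ := exists_norm_iteratedFDeriv_slice_le hrate hcont hmild hdiv 1 hs
  refine ⟨‖(curlCLM : (EuclideanSpace ℝ (Fin 3) →L[ℝ] EuclideanSpace ℝ (Fin 3)) →L[ℝ]
      EuclideanSpace ℝ (Fin 3))‖ * K, fun x => ?_⟩
  have h1 := norm_iteratedFDeriv_curl_le (n := 0) hC1 x
  rw [norm_iteratedFDeriv_zero] at h1
  exact h1.trans (mul_le_mul_of_nonneg_left (hK x) (norm_nonneg
    (curlCLM : (EuclideanSpace ℝ (Fin 3) →L[ℝ] EuclideanSpace ℝ (Fin 3)) →L[ℝ] EuclideanSpace ℝ (Fin 3))))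

/-! ### Stratum (B): harmonic vorticity on ONE slice -/

/-- **A harmonic vorticity slice is constant.** If the slice vorticity `curl v(s)`, `s < 0`, of a profile of the class
satisfies `Δ (curl v(s)) ≡ 0`, then `curl v(s)` is a constant field: each coordinate is a bounded
(`exists_norm_curl_slice_le`) harmonic function on `ℝ³`, constant by Liouville's theorem
(tree `HarmonicOnNhd.apply_eq_apply_of_abs_le`). -/
theorem curl_slice_const_of_harmonic (hrate : HasTypeITimeDecay C v)
    (hcont : ContinuousOn (uncurry v) (Iio (0 : ℝ) ×ˢ univ))
    (hmild : ∀ s t : ℝ, s < t → t < 0 → ∀ x,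
      v t x = UnboundedOperators.heatExtension (v s) (t - s) x - oseenDuhamel 1 s v v t x)
    (hdiv : ∀ t < 0, VectorCalculus.IsDivFree (v t)) {s : ℝ} (hs : s < 0)
    (hΔ : ∀ y, (Δ (curl (v s))) y = 0) : ∀ y, curl (v s) y = curl (v s) 0 := by
  have hbdd := bdd_of_hasTypeITimeDecay hrate
  have hC3 : ContDiff ℝ (2 + 1) (v s) := (analyticOnNhd_slice hcont hbdd hmild hs).contDiff
  have hω2 : ContDiff ℝ 2 (curl (v s)) := contDiff_curl hC3
  obtain ⟨K, hK⟩ := exists_norm_curl_slice_le hrate hcont hmild hdiv hs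
  intro y
  ext i
  -- the coordinate `ηᵢ = (curl v(s))ᵢ` is `C²`, harmonic and bounded
  set η : EuclideanSpace ℝ (Fin 3) → ℝ := fun z => curl (v s) z i with hη
  have hηeq : η = (EuclideanSpace.proj i : EuclideanSpace ℝ (Fin 3) →L[ℝ] ℝ) ∘ curl (v s) := by
    funext z; rfl
  have hη2 : ContDiff ℝ 2 η := by
    rw [hηeq]; exact (EuclideanSpace.proj i : EuclideanSpace ℝ (Fin 3) →L[ℝ] ℝ).contDiff.comp hω2
  have hηΔ : ∀ z, (Δ η) z = 0 := fun z => by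
    rw [hηeq, hω2.contDiffAt.laplacian_CLM_comp_left, Function.comp_apply, hΔ z, map_zero]
  have hharm : HarmonicOnNhd η univ := harmonicOnNhd_of_laplacian_eq_zero hη2 hηΔ
  have hb : ∀ z, |η z| ≤ K := fun z =>
    le_trans (by simpa [hη, Real.norm_eq_abs] using PiLp.norm_apply_le (curl (v s) z) i) (hK z)
  exact hharm.apply_eq_apply_of_abs_le hb y 0

/-- **Stratum (B).** A profile of the route's Type-I class one of whose vorticity slices is harmonic,
`Δ (curl v(s)) ≡ 0` for one `s < 0`, vanishes identically: that vorticity slice is constant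
(`curl_slice_const_of_harmonic`), hence invariant under every translation, and stratum (A) applies (with `e = e₀`).
This is the inviscid-degenerate stratum `{Δω ≡ 0}` (viscosity inactive in the vorticity equation) — the home of the
cell's `U♭` linear-vorticity family on which the infinitesimal rigidity conjecture fails; in the Type-I class it is
empty.  No poloidality is needed. -/
theorem eq_zero_of_curl_harmonic_slice (hrate : HasTypeITimeDecay C v)
    (hcont : ContinuousOn (uncurry v) (Iio (0 : ℝ) ×ˢ univ))
    (hmild : ∀ s t : ℝ, s < t → t < 0 → ∀ x,
      v t x = UnboundedOperators.heatExtension (v s) (t - s) x - oseenDuhamel 1 s v v t x)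
    (hdiv : ∀ t < 0, VectorCalculus.IsDivFree (v t)) {s : ℝ} (hs : s < 0)
    (hΔ : ∀ y, (Δ (curl (v s))) y = 0) : ∀ t < 0, ∀ x, v t x = 0 := by
  have hconst := curl_slice_const_of_harmonic hrate hcont hmild hdiv hs hΔ
  have he : (EuclideanSpace.single 0 1 : EuclideanSpace ℝ (Fin 3)) ≠ 0 := fun h => by
    simpa using congrArg (fun w : EuclideanSpace ℝ (Fin 3) => w 0) h
  exact eq_zero_of_curl_translate_eq_slice hrate hcont hmild hdiv hs he fun y l => by
    rw [hconst (y + l • EuclideanSpace.single 0 1), hconst y]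

/-- **Stratum (B), not backward-singular**: a harmonic vorticity slice ⇒ the apex `(0,0)` is not a backward singular
point. -/
theorem nonflatLiouville_of_curl_harmonic_slice (hrate : HasTypeITimeDecay C v)
    (hcont : ContinuousOn (uncurry v) (Iio (0 : ℝ) ×ˢ univ))
    (hmild : ∀ s t : ℝ, s < t → t < 0 → ∀ x,
      v t x = UnboundedOperators.heatExtension (v s) (t - s) x - oseenDuhamel 1 s v v t x)
    (hdiv : ∀ t < 0, VectorCalculus.IsDivFree (v t)) {s : ℝ} (hs : s < 0)
    (hΔ : ∀ y, (Δ (curl (v s))) y = 0) : ¬ IsBackwardSingularPoint v 0 :=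
  not_backwardSingular_of_zero (eq_zero_of_curl_harmonic_slice hrate hcont hmild hdiv hs hΔ)

end Summit.NavierStokesRegularity.NavierStokesRegularity.Theorems.PoloidalWindowDoorPoloidalWindowRigidityVorticityTranslate

end
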